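import Summits.Ventures.Crystal3D.Theorems.StickyWulffConstantGenericWallFloorSaturatedPocket
import Literature.Geometry.DiscreteGeometry.SphereNets
import HarnessLib

/-!
# Payer multiplicity: a `1`-separated configuration has at most `(1 + 2R)³` balls within distance `R` of any point
# (crux `GenericWallFloor`, stmt-Ventures-19480, line `WallLedgerG`; the MULTIPLICITY constant of the foreign-ball dichotomy)

HONEST FRAMING. Venture `Summits/Ventures/Crystal3D` (cell `crystal3d-full`), helper `--supports` the crux `GenericWallFloor`
of `route-Ventures-StickyWulffConstant`, REGISTERED line `WallLedgerG`, open stub `stub_twoSlabAdhesion`.  Rung credit only;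
F-C1 not moved; NOT the crux.  Census-free, standard axioms: the volume packing bound of Matoušek, Lemma 13.1.1 (the tree's
`Literature.Geometry.DiscreteGeometry.SphereNets.card_le_of_separated`), specialised to `ℝ³`, `η = 1`.

WHY (cf-p1 DECISION (xlii′)(2): «§51's output per class must include the payer MULTIPLICITY bound it assumes»; memo
STRUCTURAL-GLUE-g10 §3(2)).  The foreign-ball dichotomy (`unsaturated_near_or_docked_of_saturated`,
`payer_near_or_docked_of_near_endBall`) produces, for every undocked pair `(x, z)`, a payer `y ≠ z` with `dist x y ≤ 2` — so
`dist z y ≤ 2 + √3`.  One payer can serve several pairs; this file bounds HOW MANY, census-free: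
* `card_filter_dist_le_le_cube` — for a `1`-separated finite `X ⊂ ℝ³`, any point `y` and `R ≥ 0`:
  `#{x ∈ X : dist y x ≤ R} ≤ (1 + 2R)³` (real-valued);
* `card_filter_dist_le_two_le` — `R = 2`: at most `125` balls `x` within `2` of a payer;
* `card_filter_dist_le_two_add_sqrt_three_le` — `R = 2 + √3`: at most `(5 + 2√3)³ (< 911)` end balls `z` can be served by one
  payer through the dichotomy.  These are the constants of the «constant-factor device»; the sharp use remains class-by-class.
WHAT THIS IS NOT: no ledger; the constants are crude volume bounds (the true kissing-type numbers are far smaller); F-C1 not moved.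
-/

noncomputable section

namespace Summit.Ventures.Crystal3D.Theorems

open Finset Module

variable {X : Finset (EuclideanSpace ℝ (Fin 3))}

/-- **Packing count in a ball.**  In a `1`-separated finite configuration of `ℝ³`, at most `(1 + 2R)³` points lie within
distance `R` of any given point (volume bound, Matoušek Lemma 13.1.1 via `SphereNets.card_le_of_separated`). -/
theorem card_filter_dist_le_le_cube (hX : ∀ p ∈ X, ∀ q ∈ X, p ≠ q → 1 ≤ dist p q)
    (y : EuclideanSpace ℝ (Fin 3)) {R : ℝ} (hR : 0 ≤ R) :
    (((X.filter fun x => dist y x ≤ R).card : ℕ) : ℝ) ≤ (1 + 2 * R) ^ 3 := by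
  classical
  set S := X.filter fun x => dist y x ≤ R with hS
  set s := S.image (fun x => x - y) with hs
  have hinj : Set.InjOn (fun x : EuclideanSpace ℝ (Fin 3) => x - y) ↑S := fun a _ b _ h => sub_left_injective h
  have hcard : s.card = S.card := Finset.card_image_of_injOn hinj
  have hnorm : ∀ c ∈ s, ‖c‖ ≤ R := by
    intro c hc
    obtain ⟨x, hx, rfl⟩ := Finset.mem_image.1 hc
    rw [← dist_eq_norm, dist_comm]
    exact (Finset.mem_filter.1 hx).2
  have hsep : ∀ c ∈ s, ∀ d ∈ s, c ≠ d → (1 : ℝ) ≤ ‖c - d‖ := by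
    intro c hc d hd hcd
    obtain ⟨a, ha, rfl⟩ := Finset.mem_image.1 hc
    obtain ⟨b, hb, rfl⟩ := Finset.mem_image.1 hd
    have hab : a ≠ b := fun h => hcd (by rw [h])
    have h := hX a (Finset.mem_filter.1 ha).1 b (Finset.mem_filter.1 hb).1 hab
    rwa [dist_eq_norm, show a - b = (a - y) - (b - y) by abel] at h
  have key := Literature.Geometry.DiscreteGeometry.SphereNets.card_le_of_separated s hR zero_lt_one hnorm hsep
  rw [hcard, finrank_euclideanSpace_fin, div_one] at key
  exact key

/-- **At most `125` balls within distance `2`** of any point of a `1`-separated configuration (the payer-to-foreign-ball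
multiplicity of the dichotomy). -/
theorem card_filter_dist_le_two_le (hX : ∀ p ∈ X, ∀ q ∈ X, p ≠ q → 1 ≤ dist p q) (y : EuclideanSpace ℝ (Fin 3)) :
    (X.filter fun x => dist y x ≤ 2).card ≤ 125 := by
  have h := card_filter_dist_le_le_cube hX y (R := 2) (by norm_num)
  norm_num at h
  exact_mod_cast h

/-- **At most `(5 + 2√3)³` balls within distance `2 + √3`** of any point of a `1`-separated configuration (the payer-to-end-ball
multiplicity of the dichotomy: `dist z y ≤ dist z x + dist x y ≤ √3 + 2`). -/
theorem card_filter_dist_le_two_add_sqrt_three_le (hX : ∀ p ∈ X, ∀ q ∈ X, p ≠ q → 1 ≤ dist p q)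
    (y : EuclideanSpace ℝ (Fin 3)) :
    (((X.filter fun x => dist y x ≤ 2 + Real.sqrt 3).card : ℕ) : ℝ) ≤ (5 + 2 * Real.sqrt 3) ^ 3 := by
  have h := card_filter_dist_le_le_cube hX y (R := 2 + Real.sqrt 3) (by positivity)
  have e : (1 : ℝ) + 2 * (2 + Real.sqrt 3) = 5 + 2 * Real.sqrt 3 := by ring
  rwa [e] at h

/-- Numeric form: `(5 + 2√3)³ < 911`, so fewer than `911` end balls share one payer. -/
theorem card_filter_dist_le_two_add_sqrt_three_lt (hX : ∀ p ∈ X, ∀ q ∈ X, p ≠ q → 1 ≤ dist p q)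
    (y : EuclideanSpace ℝ (Fin 3)) :
    (X.filter fun x => dist y x ≤ 2 + Real.sqrt 3).card < 911 := by
  have h := card_filter_dist_le_two_add_sqrt_three_le hX y
  have hs : Real.sqrt 3 < 1.7321 := by
    rw [Real.sqrt_lt' (by norm_num)]; norm_num
  have hs0 : 0 ≤ Real.sqrt 3 := Real.sqrt_nonneg 3
  have hb : (5 + 2 * Real.sqrt 3) ^ 3 < (911 : ℝ) := by nlinarith [hs, hs0, mul_nonneg hs0 hs0]
  exact_mod_cast h.trans_lt hb

/-- Sharper numeric form: `(5 + 2√3)³ = 606.4… < 607`, so at most `606` end balls share one payer. -/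
theorem card_filter_dist_le_two_add_sqrt_three_le_606 (hX : ∀ p ∈ X, ∀ q ∈ X, p ≠ q → 1 ≤ dist p q)
    (y : EuclideanSpace ℝ (Fin 3)) :
    (X.filter fun x => dist y x ≤ 2 + Real.sqrt 3).card ≤ 606 := by
  have h := card_filter_dist_le_two_add_sqrt_three_le hX y
  have hs : Real.sqrt 3 < 1.73206 := by
    rw [Real.sqrt_lt' (by norm_num)]; norm_num
  have hs0 : 0 ≤ Real.sqrt 3 := Real.sqrt_nonneg 3
  have hb : (5 + 2 * Real.sqrt 3) ^ 3 < (607 : ℝ) := by nlinarith [hs, hs0, mul_nonneg hs0 hs0]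
  have h' : ((X.filter fun x => dist y x ≤ 2 + Real.sqrt 3).card : ℝ) < 607 := h.trans_lt hb
  have h'' : (X.filter fun x => dist y x ≤ 2 + Real.sqrt 3).card < 607 := by exact_mod_cast h'
  omega

end Summit.Ventures.Crystal3D.Theorems

end
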